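import Summits.Ventures.CertifiedManyBodySolver.Downfold.BoxesNdNiO2ELadderB
import Summits.Ventures.CertifiedManyBodySolver.Downfold.BoxesNdNiO2FillingTop
import HarnessLib

/-!
# NdNiO₂ object-E ladder, sequel C: RULING R-mg (g)(3) (dsd member `3/50` ADMITTED) propagated to object E —
# the determination-hull sub-box v2 `boxNdNiO2E_M21det2` — and WHERE THE ADMITTED DETERMINATIONS SIT relative to
# the residual corner cell of the draft route «CovNdNiO2M21» (typed as the sub-box `boxNdNiO2E_M21res`)

Cell `pub/hubbard-downfold` (S1; D-0154 (1)(C) NdNiO₂), seat hubbard-cov-ndnio2-unc-2 (lane R-ma: object E). Sequel of `BoxesNdNiO2ELadder` and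
`BoxesNdNiO2ELadderB` (§3: `boxNdNiO2E_M21det`, built on the v1 dsd member hull `[8/125, 13/100]`).
* **§1 R-mg (g)(3) on object E** (lead, HOME STATUS 2026-08-28T06:12:05Z: «Sakakibara 2020 7-orbital self-doping 3/50 ADMITTED as an orbital-occupation
  dsd member — ROW UNCHANGED by the floor reading of record»; member = `1 −` unc-3's `laNiO2Fill_n_7orb_lit`, arXiv:1909.00060 p.2 L86-93): the v2 dsd
  MEMBER HULL `ndNiO2_dsd_hull_v2 = [3/50, 13/100]` in this ladder's vocabulary, KERNEL-LINKED to unc-3's `ndNiO2Fill_dsdHull_x0_v2` / `ndNiO2Fill_dsd_members_v2`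
  (same ends, same real membership; the v2 member SET is unc-3's); `v1 ⊆ v2` (low end OUT by `1/250`); the floored row `[47/1000, 147/1000]` still
  encloses it and the INFL-4f floor still governs (`hw 7/200 < 1/20`) ⇒ every `boxNdNiO2E_M21` door of the first file is UNCHANGED; `47/50 ∈ ndNiO2E_M21_n`.
* **§2 `boxNdNiO2E_M21det2`** (VERSION RULE; `boxNdNiO2E_M21det` stays): `n ∈ 1 − [3/50, 13/100] = [87/100, 47/50]` (top up by `1/250`), other rungs verbatim;
  `det ⊆ det2 ⊆ boxNdNiO2E_M21`, downward transfers, `ndNiO2E_M21det2_mem_of_determination` (+ the form keyed to unc-3's Entry), corners, word door.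
* **§3 The residual corner cell vs the determinations.** The obs PEN's draft route «CovNdNiO2M21» (obs STATUS 2026-08-28T06:09:03Z, cruxes
  `ResidualLowUSlab` `U/t ∈ [5, 13/2]` / `ResidualHighUSlab` `[13/2, 17/2]` on `t′/t ∈ [−23/50, −11/25] × n ∈ [9/10, 477/500]`; the rest of the box is
  node-free kinematics, cov-ndnio2-box-2 `Observables/RungLeavesCoverageNdNiO2Cut`) typed as the sub-box `boxNdNiO2E_M21res ⊆ boxNdNiO2E_M21` with the
  curried-cell word door; **one explicit determination inside EACH residual slab** (`(6175/1172, −91/200, 47/50)`, `(8000/959, −91/200, 47/50)`) — neither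
  slab is «padding only»; **exact gaps from the determination hull to the leaf's binding corner `(5, −23/50, 477/500)`**: `Δt′/t = 1/200`, `Δn = 7/500`,
  `ΔU/t = 315/1172` (`303/1918` at the far `U/t` end) — the residual cell minus the determination hull = these four padding strips (FLOOR(tp/t)+print,
  INFL-4f class floor, two `U/t` outward prints); face fractions: determinations cover `3/4 × 20/27 = 5/9` of the residual `(t′, n)` face, `481/586` /
  `3533/3836` of the low / high slab's `U/t` range.

PLANNING READING `[float]`, NOT typed (plan-1's `tools/kin_corner.py` bathtub `K(t′, n)` vs bar `0.4779578`; reproduces `0.4809983` / `0.473843` first):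
`K(−0.455, 0.94) = 0.474855` (det2 corner, `−0.65 %`; v1 `−0.86 %`), `K(−0.46, 0.94) = 0.477532` (`−0.09 %`), `K(−0.455, 0.954) = 0.478352` (`+0.08 %`),
`K(−0.44, 0.954) = 0.470654` (`−1.53 %`); `K = bar` at `n = 0.9524` on `t′ = −0.455` and at `t′ = −0.4608 < −0.46` on `n = 0.94` ⇒ after R-mg (g)(3) the
box's set `{K > bar}` still lies ENTIRELY above `n = 0.94 = 1 −` (lowest admitted dsd member), i.e. in the INFL-4f padding of the `n` row; a padding-free
CONTROL word on det2 would need four-corner slack `≤ 0.0031` at `(−0.455, 0.94)` (`M = 128` table: `≈ 0.006`) — plan F2 pricing, nothing booked.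

Everything PROVED (no `sorry`). HONEST FRAMING: containment / width arithmetic on SCREENING-GRADE and `[float]` rows typed verbatim; det2 / res are NOT
boxes of record nor statement domains of record (the leaf «MOS2-ndnio2-M21» is on `boxNdNiO2E_M21`; the cells are the PEN's); the FLOOR / INFL padding is
S1's DECLARED uncertainty (ROUTER A5-i), not slack; nothing about NdNiO₂ is certified; no hull, row, word, bar or box of record is edited; box ⊂ NdNiO₂
PARENT (M21, film not superconducting) (PLD/CaH₂-capped class; MBE/atomic-H-capped films show partial onsets 5–11 K without R = 0, Parzyck 2025); no
summit statement is proved by this file.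
-/

noncomputable section

namespace Summit.Ventures.CertifiedManyBodySolver.Downfold

open Set NonemptyInterval

/-- Components of a point of a `Fin 3` box `Set.Icc ![a, b, c] ![a', b', c']` (local helper). [folklore] -/
private theorem ndC_mem_s2Box_vec3 {a b c a' b' c' : ℝ} {θ : Fin 3 → ℝ}
    (hθ : θ ∈ Set.Icc (![a, b, c] : Fin 3 → ℝ) ![a', b', c']) :
    (a ≤ θ 0 ∧ θ 0 ≤ a') ∧ (b ≤ θ 1 ∧ θ 1 ≤ b') ∧ (c ≤ θ 2 ∧ θ 2 ≤ c') := by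
  rw [Set.mem_Icc, Pi.le_def, Pi.le_def] at hθ
  obtain ⟨hlo, hhi⟩ := hθ
  have h0 := hlo 0; have h1 := hlo 1; have h2 := hlo 2
  have h0' := hhi 0; have h1' := hhi 1; have h2' := hhi 2
  simp only [Matrix.cons_val_zero, Matrix.cons_val_one, Matrix.head_cons, Matrix.cons_val_two,
    Matrix.tail_cons] at h0 h1 h2 h0' h1' h2'
  exact ⟨⟨h0, h0'⟩, ⟨h1, h1'⟩, ⟨h2, h2'⟩⟩

/-! ## §1 R-mg (g)(3) on object E: the v2 dsd member hull `[3/50, 13/100]`, the floored row unchanged, the M21 doors unchanged -/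

/-- **The v2 `dsd` MEMBER hull of the parent column** `[3/50, 13/100] = [0.06, 0.13]` (RULING R-mg (g)(3): the seven-orbital GGA self-doping
`3/50 = 1 − 47/50` of Sakakibara et al. 2020, arXiv:1909.00060 p.2 L86-93, ADMITTED as an orbital-occupation-object member beside `0.064 / 0.068 /
0.072 / 0.13`; it is the new LOW END). VERSION RULE: `ndNiO2_dsd_hull` (v1, `[8/125, 13/100]`) stays as typed; the v2 member SET is cov-ndnio2-unc-3's
(`BoxesNdNiO2FillingTop` §3). [folklore] -/
def ndNiO2_dsd_hull_v2 : NonemptyInterval ℚ := ⟨(3/50, 13/100), by norm_num⟩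

/-- The v2 hull's low end IS `1 −` unc-3's located literal `laNiO2Fill_n_7orb_lit = 47/50`, its high end is the v1 high end `13/100` (Nomura 2019);
**v1 hull ⊆ v2 hull**, the low end moved OUTWARD by exactly `8/125 − 3/50 = 1/250`. [folklore] -/
theorem ndNiO2_dsd_hull_le_v2 : ndNiO2_dsd_hull ≤ ndNiO2_dsd_hull_v2 ∧ ndNiO2_dsd_hull.fst - ndNiO2_dsd_hull_v2.fst = 1/250 ∧
    ndNiO2_dsd_hull_v2.fst = 1 - laNiO2Fill_n_7orb_lit ∧ ndNiO2_dsd_hull_v2.snd = ndNiO2_dsd_hull.snd := by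
  refine ⟨⟨?_, ?_⟩, ?_, ?_, ?_⟩ <;> simp only [ndNiO2_dsd_hull_v2, ndNiO2_dsd_hull, laNiO2Fill_n_7orb_lit] <;> norm_num

/-- **KERNEL LINK TO THE FILLING LANE (one object, two vocabularies)**: this ladder's v2 hull has EXACTLY the ends of cov-ndnio2-unc-3's typed v2 hull
`ndNiO2Fill_dsdHull_x0_v2` (`BoxesNdNiO2FillingTop` §3, p609320), real membership in the two coincides, and every element of unc-3's v2 member LIST
`ndNiO2Fill_dsd_members_v2 = [8/125, 17/250, 9/125, 13/100, 3/50]` lies in this hull. [folklore] -/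
theorem ndNiO2_dsd_hull_v2_eq_Fill :
    (ndNiO2_dsd_hull_v2.fst = ndNiO2Fill_dsdHull_x0_v2.encl.fst ∧ ndNiO2_dsd_hull_v2.snd = ndNiO2Fill_dsdHull_x0_v2.encl.snd) ∧
      (∀ d : ℝ, d ∈ ndNiO2_dsd_hull_v2.ratCast ℝ ↔ ndNiO2Fill_dsdHull_x0_v2.Mem d) ∧
      (∀ m ∈ ndNiO2Fill_dsd_members_v2, ndNiO2_dsd_hull_v2.fst ≤ m ∧ m ≤ ndNiO2_dsd_hull_v2.snd) := by
  refine ⟨⟨?_, ?_⟩, fun d => ?_, fun m hm => ?_⟩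
  · rw [ndNiO2Fill_dsdHull_x0_v2, Entry.encl_ofEnds_fst]; rfl
  · rw [ndNiO2Fill_dsdHull_x0_v2, Entry.encl_ofEnds_snd]; rfl
  · rw [mem_ratCast_iff, ndNiO2Fill_dsdHull_x0_v2, Entry.mem_ofEnds_iff]; exact Iff.rfl
  · exact ndNiO2Fill_dsd_members_v2_eq.2.1 m hm

/-- Every v1 `dsd` member (this ladder's `ndNiO2_dsd_members`) lies in the v2 hull, and both v2 ends are admitted members (`3/50`, `13/100` ∈ unc-3's v2
list) — the v2 hull is LEAST for the admitted set. [folklore] -/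
theorem ndNiO2_dsd_members_subset_hull_v2_and_ends :
    (∀ m ∈ ndNiO2_dsd_members, ndNiO2_dsd_hull_v2.fst ≤ m ∧ m ≤ ndNiO2_dsd_hull_v2.snd) ∧
      ndNiO2_dsd_hull_v2.fst ∈ ndNiO2Fill_dsd_members_v2 ∧ ndNiO2_dsd_hull_v2.snd ∈ ndNiO2Fill_dsd_members_v2 := by
  refine ⟨fun m hm => ?_, ndNiO2Fill_dsd_members_v2_eq.2.2.1, ndNiO2Fill_dsd_members_v2_eq.2.2.2⟩
  have h := ndNiO2_dsd_members_subset_hull_and_ends.1 m hm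
  exact ⟨le_trans ndNiO2_dsd_hull_le_v2.1.1 h.1, h.2.trans ndNiO2_dsd_hull_le_v2.1.2⟩

/-- **THE ROW IS UNCHANGED (R-mg (g)(3) as a theorem, object-E side)**: the floored dsd row of record `[47/1000, 147/1000]` (= `floorTo` of the v1 hull,
`ndNiO2_dsd_floor_ends`) ENCLOSES the v2 hull, its half-width is EXACTLY the INFL-4f class floor `1/20`, and the v2 hull's half-width `7/200` is still
`< 1/20` — the floor still governs (the re-centred `floorTo` of the v2 hull, `[9/200, 29/200]`, is unc-3's documented alternative, NOT of record). [folklore] -/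
theorem ndNiO2_dsd_row_encloses_hull_v2 :
    (ndNiO2_dsd_hull.floorTo (1/20)).fst ≤ ndNiO2_dsd_hull_v2.fst ∧ ndNiO2_dsd_hull_v2.snd ≤ (ndNiO2_dsd_hull.floorTo (1/20)).snd ∧
      (ndNiO2_dsd_hull.floorTo (1/20)).halfWidth = 1/20 ∧ ndNiO2_dsd_hull_v2.halfWidth = 7/200 ∧ ndNiO2_dsd_hull_v2.halfWidth < 1/20 := by
  refine ⟨?_, ?_, ?_, ?_, ?_⟩
  · rw [ndNiO2_dsd_floor_ends.1]; simp only [ndNiO2_dsd_hull_v2]; norm_num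
  · rw [ndNiO2_dsd_floor_ends.2]; simp only [ndNiO2_dsd_hull_v2]; norm_num
  · unfold NonemptyInterval.halfWidth; rw [ndNiO2_dsd_floor_ends.1, ndNiO2_dsd_floor_ends.2]; norm_num
  · simp only [ndNiO2_dsd_hull_v2, NonemptyInterval.halfWidth]; norm_num
  · simp only [ndNiO2_dsd_hull_v2, NonemptyInterval.halfWidth]; norm_num

/-- Hence every real in the v2 hull lies in the floored row of record — the hypothesis `hd` of `ndNiO2E_M21_mem_of_determination` (first file, §5) —
so **every `boxNdNiO2E_M21` / M22 / M59 / M60 membership door of the first file applies to the new member with no change**. [folklore] -/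
theorem ndNiO2_dsd_mem_row_of_mem_hull_v2 {d : ℝ} (hd : d ∈ ndNiO2_dsd_hull_v2.ratCast ℝ) :
    d ∈ (ndNiO2_dsd_hull.floorTo (1/20)).ratCast ℝ := by
  rw [mem_ratCast_iff] at hd ⊢
  have h1 : (((ndNiO2_dsd_hull.floorTo (1/20)).fst : ℚ) : ℝ) ≤ ((ndNiO2_dsd_hull_v2.fst : ℚ) : ℝ) := by
    exact_mod_cast ndNiO2_dsd_row_encloses_hull_v2.1
  have h2 : ((ndNiO2_dsd_hull_v2.snd : ℚ) : ℝ) ≤ (((ndNiO2_dsd_hull.floorTo (1/20)).snd : ℚ) : ℝ) := by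
    exact_mod_cast ndNiO2_dsd_row_encloses_hull_v2.2.1
  exact ⟨h1.trans hd.1, hd.2.trans h2⟩

/-- **The new member's filling is enclosed**: `n = 1 − 3/50 = 47/50 ∈ ndNiO2E_M21_n = [213/250, 477/500]` (margin `7/500` below the top end), read
through the first file's door `ndNiO2E_M21_n_mem_of_dsd`; and it is unc-3's located `laNiO2Fill_n_7orb_lit` cast to `ℝ`. [folklore] -/
theorem ndNiO2E_M21_n_mem_of_dsd_7orb :
    ndNiO2E_M21_n.Mem (1 - (((3/50 : ℚ)) : ℝ)) ∧ (1 - (((3/50 : ℚ)) : ℝ)) = ((laNiO2Fill_n_7orb_lit : ℚ) : ℝ) ∧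
      (477/500 : ℚ) - (1 - 3/50) = 7/500 := by
  refine ⟨ndNiO2E_M21_n_mem_of_dsd (ndNiO2_dsd_mem_row_of_mem_hull_v2 (mem_ratCast_iff.2 ⟨?_, ?_⟩)), ?_, by norm_num⟩
  · simp only [ndNiO2_dsd_hull_v2]; norm_num
  · simp only [ndNiO2_dsd_hull_v2]; norm_num
  · simp only [laNiO2Fill_n_7orb_lit]; push_cast; norm_num

/-! ## §2 `boxNdNiO2E_M21det2` — the determination-hull sub-box on the v2 dsd hull (VERSION RULE; `boxNdNiO2E_M21det` stays as typed) -/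

/-- `n` determination rung v2 `= 1 − (v2 dsd member hull) = [87/100, 47/50] = [0.87, 0.94]` (top up by `1/250` from v1's `117/125`). [folklore] -/
def ndNiO2E_M21det2_n : Entry := Entry.ofEnds (87/100) (47/50) (by norm_num) .screening

/-- **`boxNdNiO2E_M21det2`** — the DETERMINATION-HULL sub-box of column M21, object E, after R-mg (g)(3): `U/t_eff ∈ [6175/1172, 8000/959]`,
`t′/t_eff ∈ [−91/200, −9/25]`, `n ∈ [87/100, 47/50]`, `t_eff ∈ [959/2500, 293/625]` eV, `t″ = 0`. NOT a box of record. [folklore] -/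
def boxNdNiO2E_M21det2 : OneBandBox := fun c =>
  match c with
  | .UOverT => some ndNiO2E_M21det_U
  | .tpOverT => some ndNiO2E_M21det_tp
  | .filling => some ndNiO2E_M21det2_n
  | .tEV => some ndNiO2E_M21det_t
  | .tppOverT => some ndNiO2E_M21_tpp
  | _ => none

/-- **Membership in `boxNdNiO2E_M21det2` unfolded** (real inequalities, order `U/t, t′/t, n, t, t″`). [folklore] -/
theorem boxNdNiO2E_M21det2_mem_iff (p : OneBandCoord → ℝ) :
    boxNdNiO2E_M21det2.Mem p ↔
      (((6175/1172 : ℚ)) : ℝ) ≤ p .UOverT ∧ p .UOverT ≤ (((8000/959 : ℚ)) : ℝ) ∧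
      (((-91/200 : ℚ)) : ℝ) ≤ p .tpOverT ∧ p .tpOverT ≤ (((-9/25 : ℚ)) : ℝ) ∧
      (((87/100 : ℚ)) : ℝ) ≤ p .filling ∧ p .filling ≤ (((47/50 : ℚ)) : ℝ) ∧
      (((959/2500 : ℚ)) : ℝ) ≤ p .tEV ∧ p .tEV ≤ (((293/625 : ℚ)) : ℝ) ∧
      ((0 : ℚ) : ℝ) ≤ p .tppOverT ∧ p .tppOverT ≤ ((0 : ℚ) : ℝ) := by
  constructor
  · intro h
    have h0 := (Entry.mem_ofEnds_iff _ _ _ _ _).1 (h .UOverT ndNiO2E_M21det_U rfl)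
    have h1 := (Entry.mem_ofEnds_iff _ _ _ _ _).1 (h .tpOverT ndNiO2E_M21det_tp rfl)
    have h2 := (Entry.mem_ofEnds_iff _ _ _ _ _).1 (h .filling ndNiO2E_M21det2_n rfl)
    have h3 := (Entry.mem_ofEnds_iff _ _ _ _ _).1 (h .tEV ndNiO2E_M21det_t rfl)
    have h4 := (Entry.mem_ofEnds_iff _ _ _ _ _).1 (h .tppOverT ndNiO2E_M21_tpp rfl)
    exact ⟨h0.1, h0.2, h1.1, h1.2, h2.1, h2.2, h3.1, h3.2, h4.1, h4.2⟩
  · rintro ⟨a0, b0, a1, b1, a2, b2, a3, b3, a4, b4⟩ i e hi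
    cases i <;> simp only [boxNdNiO2E_M21det2, Option.some.injEq, reduceCtorEq] at hi <;> subst hi
    exacts [(Entry.mem_ofEnds_iff _ _ _ _ _).2 ⟨a0, b0⟩, (Entry.mem_ofEnds_iff _ _ _ _ _).2 ⟨a1, b1⟩, (Entry.mem_ofEnds_iff _ _ _ _ _).2 ⟨a2, b2⟩,
      (Entry.mem_ofEnds_iff _ _ _ _ _).2 ⟨a3, b3⟩, (Entry.mem_ofEnds_iff _ _ _ _ _).2 ⟨a4, b4⟩]

/-- **`boxNdNiO2E_M21det ⊆ boxNdNiO2E_M21det2`** (only the `n` top moved, outward: `117/125 ≤ 47/50`) — every word on det2 transfers DOWN to det. [folklore] -/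
theorem boxNdNiO2E_M21det_refines_det2 : boxNdNiO2E_M21det.Refines boxNdNiO2E_M21det2 := by
  intro p hp
  have hU := (Entry.mem_ofEnds_iff _ _ _ _ _).1 (hp .UOverT ndNiO2E_M21det_U rfl)
  have hS := (Entry.mem_ofEnds_iff _ _ _ _ _).1 (hp .tpOverT ndNiO2E_M21det_tp rfl)
  have hN := (Entry.mem_ofEnds_iff _ _ _ _ _).1 (hp .filling ndNiO2E_M21det_n rfl)
  have hT := (Entry.mem_ofEnds_iff _ _ _ _ _).1 (hp .tEV ndNiO2E_M21det_t rfl)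
  have hP := (Entry.mem_ofEnds_iff _ _ _ _ _).1 (hp .tppOverT ndNiO2E_M21_tpp rfl)
  rw [boxNdNiO2E_M21det2_mem_iff]
  push_cast at hU hS hN hT hP ⊢
  refine ⟨hU.1, hU.2, hS.1, hS.2, hN.1, ?_, hT.1, hT.2, hP.1, hP.2⟩
  linarith [hN.2]

/-- **`boxNdNiO2E_M21det2 ⊆ boxNdNiO2E_M21`** (`[5.2688, 8.3420] ⊆ [5, 8.5]`, `[−0.455, −0.36] ⊆ [−0.46, −0.36]`, `[0.87, 0.94] ⊆ [0.852, 0.954]`,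
`[0.3836, 0.4688] ⊆ [0.38, 0.49]`): every word on the box of record — today's kinematic word, the rung leaf if it closes — transfers DOWN. [folklore] -/
theorem boxNdNiO2E_M21det2_refines_M21 : boxNdNiO2E_M21det2.Refines boxNdNiO2E_M21 := by
  intro p hp
  rw [boxNdNiO2E_M21det2_mem_iff] at hp
  obtain ⟨a0, b0, a1, b1, a2, b2, a3, b3, a4, b4⟩ := hp
  rw [boxNdNiO2E_M21_mem_iff]
  push_cast at a0 b0 a1 b1 a2 b2 a3 b3 a4 b4 ⊢
  refine ⟨?_, ?_, ?_, ?_, ?_, ?_, ?_, ?_, a4, b4⟩ <;> linarith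

/-- Downward transfers: a word on `boxNdNiO2E_M21` holds on det2, and a word on det2 holds on det (v1). [folklore] -/
theorem holdsOn_boxNdNiO2E_M21det2_of_M21 {W : (OneBandCoord → ℝ) → Prop} (h : HoldsOn W boxNdNiO2E_M21) :
    HoldsOn W boxNdNiO2E_M21det2 ∧ HoldsOn W boxNdNiO2E_M21det :=
  ⟨h.of_refines boxNdNiO2E_M21det2_refines_M21, (h.of_refines boxNdNiO2E_M21det2_refines_M21).of_refines boxNdNiO2E_M21det_refines_det2⟩

/-- **Every un-padded determination is a member of `boxNdNiO2E_M21det2`** (after R-mg (g)(3)): `U` in the one-band hull of record (v1 or v2 `U`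
members — line (6) is interior), `t_eff` in the `t_eff` MEMBER hull, `U/t_eff = U / t_eff`, `t′/t_eff` in its member hull, `n = 1 − dsd` with `dsd`
in the v2 dsd MEMBER hull `[3/50, 13/100]`, `t″ = 0`. [folklore] -/
theorem ndNiO2E_M21det2_mem_of_determination (p : OneBandCoord → ℝ) {U d : ℝ}
    (hU : U ∈ ndNiO2_oneBandU_hull.ratCast ℝ) (ht : p .tEV ∈ ndNiO2E_t_hull.ratCast ℝ) (hUt : p .UOverT = U / p .tEV)
    (htp : p .tpOverT ∈ ndNiO2E_tp_hull.ratCast ℝ) (hd : d ∈ ndNiO2_dsd_hull_v2.ratCast ℝ) (hn : p .filling = 1 - d)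
    (htpp : p .tppOverT = 0) : boxNdNiO2E_M21det2.Mem p := by
  have hq := div_mem_Icc_ends (K := ℝ) (I := ndNiO2_oneBandU_hull) (T := ndNiO2E_t_hull)
    (by simp only [ndNiO2E_t_hull]; norm_num) (by simp only [ndNiO2_oneBandU_hull]; norm_num) hU ht
  simp only [ndNiO2_oneBandU_hull, ndNiO2E_t_hull, Set.mem_Icc] at hq
  rw [mem_ratCast_iff] at ht htp hd
  simp only [ndNiO2E_t_hull, ndNiO2E_tp_hull, ndNiO2_dsd_hull_v2] at ht htp hd
  rw [boxNdNiO2E_M21det2_mem_iff, hUt, hn, htpp]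
  push_cast at hq ht htp hd ⊢
  refine ⟨by linarith [hq.1], by linarith [hq.2], by linarith [htp.1], by linarith [htp.2], by linarith [hd.2], by linarith [hd.1],
    by linarith [ht.1], by linarith [ht.2], le_rfl, le_rfl⟩

/-- **The same door keyed to the filling lane's objects**: `dsd` given as a real member of unc-3's typed v2 hull `ndNiO2Fill_dsdHull_x0_v2` (in particular
any element of `ndNiO2Fill_dsd_members_v2`, by `ndNiO2Fill_dsdHull_x0_v2_members`). [folklore] -/
theorem ndNiO2E_M21det2_mem_of_determination_Fill (p : OneBandCoord → ℝ) {U d : ℝ}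
    (hU : U ∈ ndNiO2_oneBandU_hull.ratCast ℝ) (ht : p .tEV ∈ ndNiO2E_t_hull.ratCast ℝ) (hUt : p .UOverT = U / p .tEV)
    (htp : p .tpOverT ∈ ndNiO2E_tp_hull.ratCast ℝ) (hd : ndNiO2Fill_dsdHull_x0_v2.Mem d) (hn : p .filling = 1 - d)
    (htpp : p .tppOverT = 0) : boxNdNiO2E_M21det2.Mem p :=
  ndNiO2E_M21det2_mem_of_determination p hU ht hUt htp ((ndNiO2_dsd_hull_v2_eq_Fill.2.1 d).2 hd) hn htpp

/-- Corners of the delivered S2 box of `boxNdNiO2E_M21det2`: `(6175/1172, −91/200, 87/100)` / `(8000/959, −9/25, 47/50)`. [folklore] -/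
theorem ndNiO2E_M21det2_s2LoHi :
    s2Lo ndNiO2E_M21det_U ndNiO2E_M21det_tp ndNiO2E_M21det2_n = ![6175/1172, -91/200, 87/100] ∧
      s2Hi ndNiO2E_M21det_U ndNiO2E_M21det_tp ndNiO2E_M21det2_n = ![8000/959, -9/25, 47/50] := by
  constructor <;> (ext i; fin_cases i <;> simp [s2Lo, s2Hi, ndNiO2E_M21det_U, ndNiO2E_M21det_tp, ndNiO2E_M21det2_n])

/-- **Word door on `boxNdNiO2E_M21det2`**: ANY predicate `W` proved on the delivered box `Set.Icc ![6175/1172, −91/200, 87/100] ![8000/959, −9/25, 47/50]`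
(order `(U/t, t′/t, n)`; energy windows, stiffness ceilings `ObsStiffnessSeqCeilingAt (θ 1) (θ 0) (θ 2) c`, …) holds on the sub-box. [folklore] -/
theorem boxNdNiO2E_M21det2_word_of_s2Box {W : (Fin 3 → ℝ) → Prop}
    (hW : ∀ θ ∈ Set.Icc (![6175/1172, -91/200, 87/100] : Fin 3 → ℝ) ![8000/959, -9/25, 47/50], W θ) :
    HoldsOn (fun p : OneBandCoord → ℝ => W ![p .UOverT, p .tpOverT, p .filling]) boxNdNiO2E_M21det2 := by
  have h := holdsOn_of_forall_s2Box (B := boxNdNiO2E_M21det2) (eU := ndNiO2E_M21det_U) (eS := ndNiO2E_M21det_tp)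
    (eN := ndNiO2E_M21det2_n) rfl rfl rfl (W := W) (by rw [ndNiO2E_M21det2_s2LoHi.1, ndNiO2E_M21det2_s2LoHi.2]; exact hW)
  exact h

/-! ## §3 The residual corner cell of the draft route «CovNdNiO2M21» as a sub-box, and where the determinations sit in it -/

/-- `t′/t_eff ∈ [−23/50, −11/25]` — the deep fifth of the row of record left after cov-ndnio2-box-2's cut leaf at `−11/25`
(`Observables/RungLeavesCoverageNdNiO2Cut`). NOT an entry of record. [folklore] -/
def ndNiO2E_M21res_tp : Entry := Entry.ofEnds (-23/50) (-11/25) (by norm_num) .screening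
/-- `n ∈ [9/10, 477/500]` — the top of the filling row left after the tree leaf `ndBoxE_parent_stiffnessSeqLeaf` (`n ≤ 9/10`); unc-3's
`ndNiO2Fill_nCut_mid ∪ ndNiO2Fill_nCut_hi`. NOT an entry of record. [folklore] -/
def ndNiO2E_M21res_n : Entry := Entry.ofEnds (9/10) (477/500) (by norm_num) .screening

/-- **`boxNdNiO2E_M21res`** — the residual corner cell of the obs PEN's draft route «CovNdNiO2M21» (obs STATUS 2026-08-28T06:09:03Z: cruxes
`ResidualLowUSlab` `U/t ∈ [5, 13/2]` and `ResidualHighUSlab` `U/t ∈ [13/2, 17/2]`, both on `t′/t ∈ [−23/50, −11/25] × n ∈ [9/10, 477/500]`) typed as ONE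
sub-box of `boxNdNiO2E_M21`: `U/t_eff`, `t_eff`, `t″` verbatim from the box of record, `t′/t_eff` and `n` re-issued INWARD to the cell. NOT a box of record,
NOT a statement domain of record (the PEN's `route.json` is). [folklore] -/
def boxNdNiO2E_M21res : OneBandBox := fun c =>
  match c with
  | .UOverT => some ndNiO2E_M21_U
  | .tpOverT => some ndNiO2E_M21res_tp
  | .filling => some ndNiO2E_M21res_n
  | .tEV => some ndNiO2E_M21_t
  | .tppOverT => some ndNiO2E_M21_tpp
  | _ => none

/-- **Membership in `boxNdNiO2E_M21res` unfolded.** [folklore] -/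
theorem boxNdNiO2E_M21res_mem_iff (p : OneBandCoord → ℝ) :
    boxNdNiO2E_M21res.Mem p ↔
      ((5 : ℚ) : ℝ) ≤ p .UOverT ∧ p .UOverT ≤ (((17/2 : ℚ)) : ℝ) ∧
      (((-23/50 : ℚ)) : ℝ) ≤ p .tpOverT ∧ p .tpOverT ≤ (((-11/25 : ℚ)) : ℝ) ∧
      (((9/10 : ℚ)) : ℝ) ≤ p .filling ∧ p .filling ≤ (((477/500 : ℚ)) : ℝ) ∧
      (((19/50 : ℚ)) : ℝ) ≤ p .tEV ∧ p .tEV ≤ (((49/100 : ℚ)) : ℝ) ∧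
      ((0 : ℚ) : ℝ) ≤ p .tppOverT ∧ p .tppOverT ≤ ((0 : ℚ) : ℝ) := by
  constructor
  · intro h
    have h0 := (Entry.mem_ofEnds_iff _ _ _ _ _).1 (h .UOverT ndNiO2E_M21_U rfl)
    have h1 := (Entry.mem_ofEnds_iff _ _ _ _ _).1 (h .tpOverT ndNiO2E_M21res_tp rfl)
    have h2 := (Entry.mem_ofEnds_iff _ _ _ _ _).1 (h .filling ndNiO2E_M21res_n rfl)
    have h3 := (Entry.mem_ofEnds_iff _ _ _ _ _).1 (h .tEV ndNiO2E_M21_t rfl)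
    have h4 := (Entry.mem_ofEnds_iff _ _ _ _ _).1 (h .tppOverT ndNiO2E_M21_tpp rfl)
    exact ⟨h0.1, h0.2, h1.1, h1.2, h2.1, h2.2, h3.1, h3.2, h4.1, h4.2⟩
  · rintro ⟨a0, b0, a1, b1, a2, b2, a3, b3, a4, b4⟩ i e hi
    cases i <;> simp only [boxNdNiO2E_M21res, Option.some.injEq, reduceCtorEq] at hi <;> subst hi
    exacts [(Entry.mem_ofEnds_iff _ _ _ _ _).2 ⟨a0, b0⟩, (Entry.mem_ofEnds_iff _ _ _ _ _).2 ⟨a1, b1⟩, (Entry.mem_ofEnds_iff _ _ _ _ _).2 ⟨a2, b2⟩,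
      (Entry.mem_ofEnds_iff _ _ _ _ _).2 ⟨a3, b3⟩, (Entry.mem_ofEnds_iff _ _ _ _ _).2 ⟨a4, b4⟩]

/-- **`boxNdNiO2E_M21res ⊆ boxNdNiO2E_M21`** (two INWARD re-issues): every word on the box of record holds on the residual cell; a word on the cell
alone is NOT the leaf — the leaf needs the cell word PLUS box-2's node-free kinematics on the rest (`NdNiO2M21_StiffnessBoxCeiling_of_cornerCellLeaf`). [folklore] -/
theorem boxNdNiO2E_M21res_refines_M21 : boxNdNiO2E_M21res.Refines boxNdNiO2E_M21 := by
  intro p hp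
  rw [boxNdNiO2E_M21res_mem_iff] at hp
  obtain ⟨a0, b0, a1, b1, a2, b2, a3, b3, a4, b4⟩ := hp
  rw [boxNdNiO2E_M21_mem_iff]
  push_cast at a0 b0 a1 b1 a2 b2 a3 b3 a4 b4 ⊢
  refine ⟨a0, b0, a1, ?_, ?_, b2, a3, b3, a4, b4⟩ <;> linarith

/-- Corners of the delivered S2 box of `boxNdNiO2E_M21res`: `(5, −23/50, 9/10)` / `(17/2, −11/25, 477/500)`. [folklore] -/
theorem ndNiO2E_M21res_s2LoHi :
    s2Lo ndNiO2E_M21_U ndNiO2E_M21res_tp ndNiO2E_M21res_n = ![5, -23/50, 9/10] ∧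
      s2Hi ndNiO2E_M21_U ndNiO2E_M21res_tp ndNiO2E_M21res_n = ![17/2, -11/25, 477/500] := by
  constructor <;> (ext i; fin_cases i <;> simp [s2Lo, s2Hi, ndNiO2E_M21_U, ndNiO2E_M21res_tp, ndNiO2E_M21res_n])

/-- **Word door on `boxNdNiO2E_M21res`, vector form**: ANY predicate proved on `Set.Icc ![5, −23/50, 9/10] ![17/2, −11/25, 477/500]` (order
`(U/t, t′/t, n)`) holds on the cell. [folklore] -/
theorem boxNdNiO2E_M21res_word_of_s2Box {W : (Fin 3 → ℝ) → Prop}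
    (hW : ∀ θ ∈ Set.Icc (![5, -23/50, 9/10] : Fin 3 → ℝ) ![17/2, -11/25, 477/500], W θ) :
    HoldsOn (fun p : OneBandCoord → ℝ => W ![p .UOverT, p .tpOverT, p .filling]) boxNdNiO2E_M21res := by
  have h := holdsOn_of_forall_s2Box (B := boxNdNiO2E_M21res) (eU := ndNiO2E_M21_U) (eS := ndNiO2E_M21res_tp)
    (eN := ndNiO2E_M21res_n) rfl rfl rfl (W := W) (by rw [ndNiO2E_M21res_s2LoHi.1, ndNiO2E_M21res_s2LoHi.2]; exact hW)
  exact h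

/-- **Word door on `boxNdNiO2E_M21res`, curried CELL form** — the shape of the PEN's cruxes (`∀ tp ∈ Icc (−23/50) (−11/25), ∀ U ∈ Icc 5 (17/2),
∀ n ∈ Icc (9/10) (477/500), W tp U n`, e.g. `W := fun tp U n => ObsStiffnessSeqCeilingAt tp U n c` after the two U-slabs are joined by `le_total U (13/2)`)
⇒ the word holds on the typed cell. [folklore] -/
theorem boxNdNiO2E_M21res_word_of_cell {W : ℝ → ℝ → ℝ → Prop}
    (hW : ∀ tp ∈ Set.Icc (-23/50 : ℝ) (-11/25), ∀ U ∈ Set.Icc (5 : ℝ) (17/2), ∀ n ∈ Set.Icc (9/10 : ℝ) (477/500), W tp U n) :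
    HoldsOn (fun p : OneBandCoord → ℝ => W (p .tpOverT) (p .UOverT) (p .filling)) boxNdNiO2E_M21res := by
  have h := boxNdNiO2E_M21res_word_of_s2Box (W := fun θ => W (θ 1) (θ 0) (θ 2)) (fun θ hθ => by
    obtain ⟨hU, htp, hn⟩ := ndC_mem_s2Box_vec3 hθ
    exact hW (θ 1) htp (θ 0) hU (θ 2) hn)
  intro p hp
  have := h p hp
  simpa only [Matrix.cons_val_zero, Matrix.cons_val_one, Matrix.head_cons, Matrix.cons_val_two, Matrix.tail_cons] using this

/-- **A determination INSIDE the residual cell, LOW-U slab**: the object-E parameter vector `(U/t_eff, t′/t_eff, n, t_eff, t″) = (6175/1172, −91/200,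
47/50, 293/625, 0)` — `U = 2.47` eV (in-house cRPA(W) 26-Ry member) over `t_eff = 0.4688` eV (the `x = 0.2` charged-cell (W) refit member), `t′/t_eff =
−0.455` (the (D) p0 refit member), `n = 1 − 3/50` (the R-mg (g)(3) member) — lies in `boxNdNiO2E_M21det2` AND in `boxNdNiO2E_M21res`, with `U/t < 13/2`.
[folklore] -/
theorem ndNiO2E_det2_res_witness_lowU :
    let p : OneBandCoord → ℝ := fun c => match c with
      | .UOverT => 6175/1172 | .tpOverT => -91/200 | .filling => 47/50 | .tEV => 293/625 | _ => 0
    boxNdNiO2E_M21det2.Mem p ∧ boxNdNiO2E_M21res.Mem p ∧ p .UOverT < 13/2 ∧ p .UOverT = (247/100 : ℝ) / (293/625) := by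
  refine ⟨?_, ?_, by norm_num, by norm_num⟩
  · rw [boxNdNiO2E_M21det2_mem_iff]; push_cast; norm_num
  · rw [boxNdNiO2E_M21res_mem_iff]; push_cast; norm_num

/-- **A determination INSIDE the residual cell, HIGH-U slab**: `(U/t_eff, t′/t_eff, n, t_eff, t″) = (8000/959, −91/200, 47/50, 959/2500, 0)` — `U = 3.2` eV
(Kitatani 2020) over `t_eff = 0.3836` eV (the (D) p0 refit at `n = 0.928`, `w = 0.3`), same `t′/t_eff` and `n` — lies in both boxes, with `13/2 < U/t`. [folklore] -/
theorem ndNiO2E_det2_res_witness_highU :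
    let p : OneBandCoord → ℝ := fun c => match c with
      | .UOverT => 8000/959 | .tpOverT => -91/200 | .filling => 47/50 | .tEV => 959/2500 | _ => 0
    boxNdNiO2E_M21det2.Mem p ∧ boxNdNiO2E_M21res.Mem p ∧ (13/2 : ℝ) < p .UOverT ∧ p .UOverT = (32/10 : ℝ) / (959/2500) := by
  refine ⟨?_, ?_, by norm_num, by norm_num⟩
  · rw [boxNdNiO2E_M21det2_mem_iff]; push_cast; norm_num
  · rw [boxNdNiO2E_M21res_mem_iff]; push_cast; norm_num

/-- **THE GAPS FROM THE DETERMINATION HULL TO THE LEAF'S BINDING CORNER `(U/t, t′/t, n) = (5, −23/50, 477/500)`, exact**: every point of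
`boxNdNiO2E_M21det2` has `t′/t ≥ −23/50 + 1/200`, `n ≤ 477/500 − 7/500`, `U/t ≥ 5 + 315/1172` and `U/t ≤ 17/2 − 303/1918` — no admitted determination
comes closer to the corner than `1/200` in `t′/t`, `7/500` in `n`, `315/1172 ≈ 0.269` in `U/t`. [folklore] -/
theorem ndNiO2E_det2_gaps_to_bindingCorner (p : OneBandCoord → ℝ) (hp : boxNdNiO2E_M21det2.Mem p) :
    (-23/50 : ℝ) + 1/200 ≤ p .tpOverT ∧ p .filling ≤ (477/500 : ℝ) - 7/500 ∧
      (5 : ℝ) + 315/1172 ≤ p .UOverT ∧ p .UOverT ≤ (17/2 : ℝ) - 303/1918 := by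
  rw [boxNdNiO2E_M21det2_mem_iff] at hp
  obtain ⟨a0, b0, a1, -, -, b2, -, -, -, -⟩ := hp
  push_cast at a0 b0 a1 b2
  refine ⟨by linarith, by linarith, by linarith, by linarith⟩

/-- The four gap literals ARE the differences of the typed ends (no hidden constant): `−91/200 − (−23/50) = 1/200`, `477/500 − 47/50 = 7/500`,
`6175/1172 − 5 = 315/1172`, `17/2 − 8000/959 = 303/1918`; and the v2 `n` rung's ends ARE `1 −` the v2 dsd hull's ends, its top up by exactly `1/250`
from the v1 rung `ndNiO2E_M21det_n`. [folklore] -/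
theorem ndNiO2E_det2_gap_literals :
    (ndNiO2E_M21det_tp.encl.fst - ndNiO2E_M21_tp.encl.fst = 1/200 ∧ ndNiO2E_M21_n.encl.snd - ndNiO2E_M21det2_n.encl.snd = 7/500 ∧
      ndNiO2E_M21det_U.encl.fst - ndNiO2E_M21_U.encl.fst = 315/1172 ∧ ndNiO2E_M21_U.encl.snd - ndNiO2E_M21det_U.encl.snd = 303/1918) ∧
    (ndNiO2E_M21det2_n.encl.fst = 1 - ndNiO2_dsd_hull_v2.snd ∧ ndNiO2E_M21det2_n.encl.snd = 1 - ndNiO2_dsd_hull_v2.fst ∧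
      ndNiO2E_M21det2_n.encl.snd - ndNiO2E_M21det_n.encl.snd = 1/250) := by
  simp only [ndNiO2E_M21det_tp, ndNiO2E_M21_tp, ndNiO2E_M21_n, ndNiO2E_M21det2_n, ndNiO2E_M21det_n, ndNiO2E_M21det_U, ndNiO2E_M21_U,
    ndNiO2_dsd_hull_v2, Entry.encl_ofEnds_fst, Entry.encl_ofEnds_snd]; norm_num

/-- **RESIDUAL CELL = (DETERMINATION-HULL SHADOW) ∪ FOUR PADDING STRIPS**: a point of `boxNdNiO2E_M21res` either has its `(U/t, t′/t, n)` shadow inside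
`boxNdNiO2E_M21det2`'s (the first six conjuncts of `boxNdNiO2E_M21det2_mem_iff`; `t′/t ≤ −9/25` and `n ≥ 87/100` are automatic on the cell), or lies in the
FLOOR(tp/t)+print strip `t′/t < −91/200` (width `1/200`), the INFL-4f class-floor strip `n > 47/50` (width `7/500`), or one of the two `U/t` outward-print
strips `U/t < 6175/1172` / `U/t > 8000/959` — the cell's widening conventions, not admitted determinations. [folklore] -/
theorem ndNiO2E_res_det2Shadow_or_padding (p : OneBandCoord → ℝ) (hp : boxNdNiO2E_M21res.Mem p) :
    ((((6175/1172 : ℚ)) : ℝ) ≤ p .UOverT ∧ p .UOverT ≤ (((8000/959 : ℚ)) : ℝ) ∧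
      (((-91/200 : ℚ)) : ℝ) ≤ p .tpOverT ∧ p .tpOverT ≤ (((-9/25 : ℚ)) : ℝ) ∧
      (((87/100 : ℚ)) : ℝ) ≤ p .filling ∧ p .filling ≤ (((47/50 : ℚ)) : ℝ)) ∨
    (p .tpOverT < -91/200 ∨ (47/50 : ℝ) < p .filling ∨ p .UOverT < 6175/1172 ∨ (8000/959 : ℝ) < p .UOverT) := by
  rw [boxNdNiO2E_M21res_mem_iff] at hp
  obtain ⟨-, -, -, b1, a2, -, -, -, -, -⟩ := hp
  push_cast at b1 a2 ⊢
  by_cases h1 : p .tpOverT < -91/200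
  · exact Or.inr (Or.inl h1)
  by_cases h2 : (47/50 : ℝ) < p .filling
  · exact Or.inr (Or.inr (Or.inl h2))
  by_cases h3 : p .UOverT < 6175/1172
  · exact Or.inr (Or.inr (Or.inr (Or.inl h3)))
  by_cases h4 : (8000/959 : ℝ) < p .UOverT
  · exact Or.inr (Or.inr (Or.inr (Or.inr h4)))
  rw [not_lt] at h1 h2 h3 h4
  exact Or.inl ⟨h3, h4, h1, by linarith, by linarith, h2⟩

/-- **FACE FRACTIONS (exact)**: the determination hull covers `3/4` of the residual cell's `t′/t` range (`[−91/200, −11/25]` of `[−23/50, −11/25]`),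
`20/27` of its `n` range (`[9/10, 47/50]` of `[9/10, 477/500]`) ⇒ `5/9` of the `(t′, n)` face; and `481/586 ≈ 0.82` of the low slab's `U/t` range
`[5, 13/2]`, `3533/3836 ≈ 0.92` of the high slab's `[13/2, 17/2]`. The complementary `4/9` of the face is padding-only. [folklore] -/
theorem ndNiO2E_res_det2_fractions :
    (((-11/25 : ℚ) - (-91/200)) / ((-11/25) - (-23/50)) = 3/4) ∧ (((47/50 : ℚ) - 9/10) / (477/500 - 9/10) = 20/27) ∧
      ((3/4 : ℚ) * (20/27) = 5/9) ∧ (((13/2 : ℚ) - 6175/1172) / (13/2 - 5) = 481/586) ∧ (((8000/959 : ℚ) - 13/2) / (17/2 - 13/2) = 3533/3836) := by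
  refine ⟨?_, ?_, ?_, ?_, ?_⟩ <;> norm_num

end Summit.Ventures.CertifiedManyBodySolver.Downfold

end
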